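import Literature.Probability.RandomPlanarGeometry.SAWIrreducibleBridgeThreeSpanExtremal
import Literature.Probability.RandomPlanarGeometry.SAWPulledLargeForceExpansionZdFirstOrder
import HarnessLib

/-!
# The pulled self-avoiding walk on `ℤ^{d+1}`: the extremal irreducible bridges are the `2d(2d−1)` staples —
# `N_{2A,3A} = 2d(2d−1)` for every span `A ≥ 2`

Topic `Literature/Probability/RandomPlanarGeometry` (combines `SAWIrreducibleBridgeThreeSpanExtremal.lean` — an irreducible bridge of
length `3A` (`A ≥ 2` its span) has the staple height profile `U^A T D^{A−1} T U^{A−1}` — with the transverse-step tools of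
`SAWPulledLargeForceExpansionZdFirstOrder.lean` (`twoStepV`, `exists_twoStepV_of_adj`, `eq_add_e0_of_adj`, `eq_sub_e0_of_adj`,
`threeStepIndex`, `card_threeStepIndex = 2d(2d−1)`) and the cost grading `costCoeffZd` of `SAWPulledLargeForceExpansionZd.lean`).

The staple with transverse steps `v` (at height `A`) and `w` (at height `1`) is self-avoiding iff `w ≠ −v`; so the irreducible bridges of
span `A` and the minimal length `3A` are in bijection with `threeStepIndex` — in the cost grading (`cost = 3A − A = 2A`):
★★ **`costCoeffZd d (2A) (3A) = 2d(2d−1)` for every `A ≥ 2`** — the top-length coefficient of every EVEN cost polynomial of the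
large-force expansion is the constant `2d(2d−1)` (the hooks `N_{4,6}` and the double hooks `N_{6,9}` are the first two instances), while
`SAWIrreducibleBridgeThreeSpan` makes the top length `⌊3c/2⌋`. [cite: MadrasSlade1993, §4.2, remark after Theorem 4.2.4 (p. 94)]

## Contents (all PROVED, standard axioms; no data)
`staple` (the walk family, four phases), value/height lemmas, `staple_mem_saws`, `staple_mem_filter`, ★ `eq_staple_of_mem`,
`staple_injective`, `filter_costZd_staple_eq_image`, ★★ `costCoeffZd_two_mul_three_mul`. Provenance: lane «pcv-sawmu», a-p3 g16 (2026-08-24).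
-/

noncomputable section

open Finset
open scoped BigOperators
open Literature.Probability.LatticeModels
open Literature.Probability.RandomPlanarGeometry.SAW

namespace Literature.Probability.RandomPlanarGeometry.SAW.Zd

/-! ### The staples -/

/-- The staple of span `s` with transverse steps `p = (v, w)`: `t ↦ t e₀` (`t ≤ s`), `(2s+1−t) e₀ + v` (`s < t ≤ 2s`),
`(t−2s) e₀ + v + w` (`2s < t ≤ 3s`), frozen from `3s`. [cite: MadrasSlade1993, Definition 1.2.4] -/
def staple (d s : ℕ) (p : (Fin d × Bool) × (Fin d × Bool)) (t : ℕ) : Site (d + 1) :=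
  if t ≤ s then Pi.single 0 (t : ℤ)
  else if t ≤ 2 * s then Pi.single 0 ((s : ℤ) - ((t - s - 1 : ℕ) : ℤ)) + twoStepV d p.1
  else if t ≤ 3 * s then Pi.single 0 ((1 : ℤ) + ((t - 2 * s - 1 : ℕ) : ℤ)) + twoStepV d p.1 + twoStepV d p.2
  else Pi.single 0 (s : ℤ) + twoStepV d p.1 + twoStepV d p.2

/-- Phase 0. [cite: MadrasSlade1993, Definition 1.2.4] -/
theorem staple_of_le (d s : ℕ) (p) {t : ℕ} (ht : t ≤ s) : staple d s p t = Pi.single 0 (t : ℤ) := by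
  simp [staple, ht]

/-- Phase 1 (`t = s + 1 + j`, `j ≤ s − 1`). [cite: MadrasSlade1993, Definition 1.2.4] -/
theorem staple_phase_one (d s : ℕ) (p) {j : ℕ} (hj : j + 1 ≤ s) :
    staple d s p (s + 1 + j) = Pi.single 0 ((s : ℤ) - j) + twoStepV d p.1 := by
  have h1 : ¬ (s + 1 + j ≤ s) := by omega
  have h2 : s + 1 + j ≤ 2 * s := by omega
  simp only [staple, if_neg h1, if_pos h2, show s + 1 + j - s - 1 = j by omega]

/-- Phase 2 (`t = 2s + 1 + j`, `j ≤ s − 1`). [cite: MadrasSlade1993, Definition 1.2.4] -/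
theorem staple_phase_two (d s : ℕ) (p) {j : ℕ} (hj : j + 1 ≤ s) :
    staple d s p (2 * s + 1 + j) = Pi.single 0 ((1 : ℤ) + j) + twoStepV d p.1 + twoStepV d p.2 := by
  have h1 : ¬ (2 * s + 1 + j ≤ s) := by omega
  have h2 : ¬ (2 * s + 1 + j ≤ 2 * s) := by omega
  have h3 : 2 * s + 1 + j ≤ 3 * s := by omega
  simp only [staple, if_neg h1, if_neg h2, if_pos h3, show 2 * s + 1 + j - 2 * s - 1 = j by omega]

/-- Frozen from `3s`. [cite: MadrasSlade1993, Definition 1.2.4] -/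
theorem staple_of_ge (d s : ℕ) (hs : 1 ≤ s) (p) {t : ℕ} (ht : 3 * s ≤ t) :
    staple d s p t = Pi.single 0 (s : ℤ) + twoStepV d p.1 + twoStepV d p.2 := by
  rcases Nat.lt_or_ge (3 * s) t with h | h
  · have h1 : ¬ (t ≤ s) := by omega
    have h2 : ¬ (t ≤ 2 * s) := by omega
    have h3 : ¬ (t ≤ 3 * s) := by omega
    simp only [staple, if_neg h1, if_neg h2, if_neg h3]
  · obtain rfl : t = 3 * s := le_antisymm h ht
    have := staple_phase_two d s p (j := s - 1) (by omega)
    rw [show 2 * s + 1 + (s - 1) = 3 * s by omega] at this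
    rw [this]
    congr 2
    push_cast [Nat.cast_sub hs]
    ring

/-- Heights of the staple. [cite: MadrasSlade1993, Definition 1.2.4] -/
theorem staple_apply_zero (d s : ℕ) (hs : 1 ≤ s) (p) (t : ℕ) :
    staple d s p t 0 = if t ≤ s then (t : ℤ) else if t ≤ 2 * s then 2 * s + 1 - t else if t ≤ 3 * s then (t : ℤ) - 2 * s else s := by
  by_cases h1 : t ≤ s
  · rw [staple_of_le d s p h1, if_pos h1]; simp
  rw [if_neg h1]
  by_cases h2 : t ≤ 2 * s
  · obtain ⟨j, rfl⟩ : ∃ j, t = s + 1 + j := ⟨t - s - 1, by omega⟩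
    rw [staple_phase_one d s p (by omega), if_pos h2]
    simp only [Pi.add_apply, Pi.single_eq_same, twoStepV_apply_zero, add_zero]
    push_cast; ring
  rw [if_neg h2]
  by_cases h3 : t ≤ 3 * s
  · obtain ⟨j, rfl⟩ : ∃ j, t = 2 * s + 1 + j := ⟨t - 2 * s - 1, by omega⟩
    rw [staple_phase_two d s p (by omega), if_pos h3]
    simp only [Pi.add_apply, Pi.single_eq_same, twoStepV_apply_zero, add_zero]
    push_cast; ring
  · rw [if_neg h3, staple_of_ge d s hs p (by omega)]
    simp

/-- The transverse part of the staple: `0`, `v`, `v + w` by phase. [cite: MadrasSlade1993, Definition 1.2.4] -/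
theorem staple_sub_single (d s : ℕ) (hs : 1 ≤ s) (p) (t : ℕ) :
    staple d s p t - Pi.single 0 (staple d s p t 0) =
      if t ≤ s then 0 else if t ≤ 2 * s then twoStepV d p.1 else twoStepV d p.1 + twoStepV d p.2 := by
  by_cases h1 : t ≤ s
  · rw [if_pos h1, staple_of_le d s p h1]; simp
  rw [if_neg h1]
  by_cases h2 : t ≤ 2 * s
  · obtain ⟨j, rfl⟩ : ∃ j, t = s + 1 + j := ⟨t - s - 1, by omega⟩
    rw [if_pos h2, staple_phase_one d s p (by omega)]
    simp
  rw [if_neg h2]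
  by_cases h3 : t ≤ 3 * s
  · obtain ⟨j, rfl⟩ : ∃ j, t = 2 * s + 1 + j := ⟨t - 2 * s - 1, by omega⟩
    rw [staple_phase_two d s p (by omega)]
    simp; abel
  · rw [staple_of_ge d s hs p (by omega)]
    simp; abel

/-- The staple with `w ≠ −v` is a `3s`-step self-avoiding walk (`s ≥ 1`). [cite: MadrasSlade1993, Definition 1.2.4] -/
theorem staple_mem_saws (d s : ℕ) (hs : 1 ≤ s) {p} (hp : p ∈ threeStepIndex d) : staple d s p ∈ saws (d + 1) (3 * s) := by
  have hvw : p.2 ≠ (p.1.1, !p.1.2) := (Finset.mem_filter.1 hp).2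
  have hv0 : twoStepV d p.1 ≠ 0 := twoStepV_ne_zero d p.1
  have hw0 : twoStepV d p.2 ≠ 0 := twoStepV_ne_zero d p.2
  have hvw0 : twoStepV d p.1 + twoStepV d p.2 ≠ 0 := fun h => hvw (twoStepV_add_eq_zero d h)
  refine mem_saws.2 ⟨by rw [staple_of_le d s p (Nat.zero_le _)]; simp, fun i hi => ?_, fun i hi => ?_, ?_⟩
  · rw [staple_of_ge d s hs p hi, staple_of_ge d s hs p le_rfl]
  · -- adjacency, by phase of the step `i → i + 1`
    rcases Nat.lt_or_ge (i + 1) (s + 1) with h1 | h1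
    · rw [staple_of_le d s p (by omega), staple_of_le d s p (by omega), zdGraph_adj_iff]
      exact ⟨0, Or.inl (by rw [← Pi.single_add]; push_cast; ring_nf)⟩
    rcases Nat.lt_or_ge i (s + 1) with h2 | h2
    · -- `i = s`: transverse step `v`
      rw [show i = s by omega]
      have e1 := staple_phase_one d s p (j := 0) hs
      rw [add_zero] at e1
      rw [staple_of_le d s p le_rfl, e1, Nat.cast_zero, sub_zero]
      exact adj_add_twoStepV d _ _
    rcases Nat.lt_or_ge (i + 1) (2 * s + 1) with h3 | h3
    · -- down-run
      obtain ⟨j, rfl⟩ : ∃ j, i = s + 1 + j := ⟨i - s - 1, by omega⟩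
      rw [staple_phase_one d s p (by omega), show s + 1 + j + 1 = s + 1 + (j + 1) by ring, staple_phase_one d s p (by omega),
        zdGraph_adj_iff]
      refine ⟨0, Or.inr ?_⟩
      rw [add_right_comm, ← Pi.single_add]; push_cast; ring_nf
    rcases Nat.lt_or_ge i (2 * s + 1) with h4 | h4
    · -- `i = 2s`: transverse step `w`
      obtain rfl : i = 2 * s := by omega
      have e1 := staple_phase_one d s p (j := s - 1) (by omega)
      rw [show s + 1 + (s - 1) = 2 * s by omega] at e1
      have e2 := staple_phase_two d s p (j := 0) hs
      rw [add_zero] at e2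
      rw [e1, e2]
      have : ((s : ℤ) - ((s - 1 : ℕ) : ℤ)) = (1 : ℤ) + ((0 : ℕ) : ℤ) := by push_cast [Nat.cast_sub hs]; ring
      rw [this]
      exact adj_add_twoStepV d _ _
    · -- final ascent
      obtain ⟨j, rfl⟩ : ∃ j, i = 2 * s + 1 + j := ⟨i - 2 * s - 1, by omega⟩
      rw [staple_phase_two d s p (by omega), show 2 * s + 1 + j + 1 = 2 * s + 1 + (j + 1) by ring,
        staple_phase_two d s p (by omega), zdGraph_adj_iff]
      refine ⟨0, Or.inl ?_⟩
      have : ((1 : ℤ) + ((j + 1 : ℕ) : ℤ)) = ((1 : ℤ) + (j : ℕ)) + 1 := by push_cast; ring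
      rw [this, Pi.single_add]; abel
  · -- injectivity: the transverse part fixes the phase, the height the index
    intro i hi j hj h
    simp only [Set.mem_setOf_eq] at hi hj
    have hh : staple d s p i 0 = staple d s p j 0 := by rw [h]
    have ht : staple d s p i - Pi.single 0 (staple d s p i 0) = staple d s p j - Pi.single 0 (staple d s p j 0) := by rw [h]
    rw [staple_sub_single d s hs, staple_sub_single d s hs] at ht
    rw [staple_apply_zero d s hs, staple_apply_zero d s hs] at hh
    have hw' : twoStepV d p.1 ≠ twoStepV d p.1 + twoStepV d p.2 := by
      intro h'; exact hw0 (by simpa using h'.symm)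
    by_cases hi1 : i ≤ s <;> by_cases hj1 : j ≤ s <;> simp only [hi1, hj1, if_true, if_false] at ht hh
    · exact_mod_cast hh
    · by_cases hj2 : j ≤ 2 * s <;> simp only [hj2, if_true, if_false] at ht
      · exact absurd ht.symm hv0
      · exact absurd ht.symm hvw0
    · by_cases hi2 : i ≤ 2 * s <;> simp only [hi2, if_true, if_false] at ht
      · exact absurd ht hv0
      · exact absurd ht hvw0
    · by_cases hi2 : i ≤ 2 * s <;> by_cases hj2 : j ≤ 2 * s <;> simp only [hi2, hj2, if_true, if_false] at ht hh
      · omega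
      · exact absurd ht hw'
      · exact absurd ht.symm hw'
      · have hi3 : i ≤ 3 * s := hi
        have hj3 : j ≤ 3 * s := hj
        simp only [hi3, hj3, if_true] at hh
        omega

/-- The staple is an irreducible bridge of span `s` and cost `2s` (`s ≥ 1`, `w ≠ −v`). [cite: DuminilCopinHammond2013, §2.2] -/
theorem staple_mem_filter (d s : ℕ) (hs : 1 ≤ s) {p} (hp : p ∈ threeStepIndex d) :
    staple d s p ∈ (irreducibleBridges (d + 1) (3 * s)).filter fun ω => costZd d (3 * s) ω = 2 * s := by
  have hH := staple_apply_zero d s hs p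
  have hH0 : staple d s p 0 0 = 0 := by rw [staple_of_le d s p (Nat.zero_le _)]; simp
  have hH3 : staple d s p (3 * s) 0 = s := by rw [staple_of_ge d s hs p le_rfl]; simp
  have hb : IsBridge (3 * s) (staple d s p) := by
    intro i h1 h3
    rw [hH0, hH3, hH]
    split_ifs <;> constructor <;> omega
  refine Finset.mem_filter.2 ⟨mem_irreducibleBridges.2 ⟨mem_bridges.2 ⟨staple_mem_saws d s hs hp, hb⟩,
    ⟨by omega, hb, fun k hk1 hk2 hren => ?_⟩⟩, ?_⟩
  · obtain ⟨-, hb1, hb2⟩ := hren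
    rcases Nat.lt_or_ge k (2 * s) with hk | hk
    · -- later time `2s + 1` has height `1 ≤ h k`
      have h' := (hb2 (2 * s + 1 - k) (by omega) (by omega)).1
      simp only [add_zero] at h'
      rw [show k + (2 * s + 1 - k) = 2 * s + 1 by omega, hH, hH, if_neg (show ¬ 2 * s + 1 ≤ s by omega),
        if_neg (show ¬ 2 * s + 1 ≤ 2 * s by omega), if_pos (show 2 * s + 1 ≤ 3 * s by omega)] at h'
      split_ifs at h' <;> push_cast at h' <;> omega
    rcases Nat.lt_or_ge k (2 * s + 1) with hk' | hk'
    · -- `k = 2s`: later time `2s+1` has height `1 = h (2s)`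
      obtain rfl : k = 2 * s := by omega
      have h' := (hb2 1 le_rfl (by omega)).1
      simp only [add_zero] at h'
      rw [hH, hH, if_neg (show ¬ 2 * s + 1 ≤ s by omega), if_neg (show ¬ 2 * s + 1 ≤ 2 * s by omega),
        if_pos (show 2 * s + 1 ≤ 3 * s by omega), if_neg (show ¬ 2 * s ≤ s by omega), if_pos le_rfl] at h'
      push_cast at h'; omega
    · -- `k ≥ 2s + 1`: earlier time `s` has height `s > h k`
      have h' := (hb1 s hs (by omega)).2
      rw [hH, hH, if_pos le_rfl, if_neg (show ¬ k ≤ s by omega), if_neg (show ¬ k ≤ 2 * s by omega), if_pos (by omega)] at h'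
      omega
  · show costZd d (3 * s) (staple d s p) = 2 * s
    simp only [costZd]
    rw [hH3]
    omega

/-! ### Every extremal irreducible bridge is a staple -/

/-- ★ **An irreducible bridge of `ℤ^{d+1}` of length `3s` and cost `2s` (`s ≥ 2`) is a staple `staple d s (v, w)` with `w ≠ −v`.**
[cite: MadrasSlade1993, §4.2, remark after Theorem 4.2.4 (p. 94)] -/
theorem eq_staple_of_mem (d s : ℕ) (hs : 2 ≤ s) {ω : ℕ → Site (d + 1)}
    (hω : ω ∈ (irreducibleBridges (d + 1) (3 * s)).filter fun ω => costZd d (3 * s) ω = 2 * s) :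
    ∃ p ∈ threeStepIndex d, ω = staple d s p := by
  obtain ⟨hirr, hcost⟩ := Finset.mem_filter.1 hω
  obtain ⟨hbr, -⟩ := mem_irreducibleBridges.1 hirr
  obtain ⟨hωs, hb⟩ := mem_bridges.1 hbr
  obtain ⟨h0, hend, hadj, hinj⟩ := mem_saws.1 hωs
  -- span `s`
  have hspan : ω (3 * s) 0 = s := by
    simp only [costZd] at hcost
    have := (span_le_and_cost_bound_zd hirr).1
    have hpos : 0 < ω (3 * s) 0 := by have := (hb (3 * s) (by omega) le_rfl).1; rwa [h0] at this
    omega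
  -- the forced height profile
  have hprof := heights_of_length_eq_three_mul_span hirr (by rw [hspan]; simp; omega) (by rw [hspan]; push_cast; ring)
  rw [hspan] at hprof
  have H : ∀ t, t ≤ 3 * s → ω t 0 = if t ≤ s then (t : ℤ) else if t ≤ 2 * s then 2 * s + 1 - t else (t : ℤ) - 2 * s := by
    intro t ht
    rw [hprof t ht]
    by_cases h1 : t ≤ s
    · rw [if_pos (by exact_mod_cast h1), if_pos h1]
    rw [if_neg (by omega), if_neg h1]
    by_cases h2 : t ≤ 2 * s
    · rw [if_pos (by omega), if_pos h2]
    · rw [if_neg (by omega), if_neg h2]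
  -- the two transverse steps
  obtain ⟨v, hv⟩ := exists_twoStepV_of_adj d (hadj s (by omega))
    (by rw [H (s + 1) (by omega), H s (by omega), if_neg (by omega), if_pos (by omega), if_pos le_rfl]; push_cast; ring)
  obtain ⟨w, hw⟩ := exists_twoStepV_of_adj d (hadj (2 * s) (by omega))
    (by rw [H (2 * s + 1) (by omega), H (2 * s) (by omega), if_neg (by omega), if_neg (by omega), if_neg (by omega),
      if_pos le_rfl]; push_cast; ring)
  -- phase 0: `ω t = t e₀`
  have P0 : ∀ t, t ≤ s → ω t = Pi.single 0 (t : ℤ) := by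
    intro t
    induction t with
    | zero => intro _; rw [h0]; simp
    | succ t ih =>
      intro ht
      have hup : ω (t + 1) 0 = ω t 0 + 1 := by
        rw [H (t + 1) (by omega), H t (by omega), if_pos (by omega), if_pos (by omega)]; push_cast; ring
      rw [eq_add_e0_of_adj d (hadj t (by omega)) hup, ih (by omega), ← Pi.single_add]
      push_cast; ring_nf
  -- phase 1: `ω (s+1+j) = (s−j) e₀ + v`
  have P1 : ∀ j, j + 1 ≤ s → ω (s + 1 + j) = Pi.single 0 ((s : ℤ) - j) + twoStepV d v := by
    intro j
    induction j with
    | zero => intro _; rw [add_zero, hv, P0 s le_rfl]; simp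
    | succ j ih =>
      intro hj
      have hdown : ω (s + 1 + j + 1) 0 = ω (s + 1 + j) 0 - 1 := by
        rw [H (s + 1 + j + 1) (by omega), H (s + 1 + j) (by omega), if_neg (by omega), if_pos (by omega), if_neg (by omega),
          if_pos (by omega)]
        push_cast; ring
      rw [show s + 1 + (j + 1) = s + 1 + j + 1 by ring, eq_sub_e0_of_adj d (hadj (s + 1 + j) (by omega)) hdown, ih (by omega)]
      rw [add_sub_right_comm, ← Pi.single_sub]
      push_cast; ring_nf
  -- phase 2: `ω (2s+1+j) = (1+j) e₀ + v + w`
  have P2 : ∀ j, j + 1 ≤ s → ω (2 * s + 1 + j) = Pi.single 0 ((1 : ℤ) + j) + twoStepV d v + twoStepV d w := by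
    intro j
    induction j with
    | zero =>
      intro _
      have e := P1 (s - 1) (by omega)
      rw [show s + 1 + (s - 1) = 2 * s by omega] at e
      rw [add_zero, hw, e]
      congr 2
      push_cast [Nat.cast_sub (show 1 ≤ s by omega)]; ring
    | succ j ih =>
      intro hj
      have hup : ω (2 * s + 1 + j + 1) 0 = ω (2 * s + 1 + j) 0 + 1 := by
        rw [H (2 * s + 1 + j + 1) (by omega), H (2 * s + 1 + j) (by omega), if_neg (by omega), if_neg (by omega),
          if_neg (by omega), if_neg (by omega)]
        push_cast; ring
      rw [show 2 * s + 1 + (j + 1) = 2 * s + 1 + j + 1 by ring, eq_add_e0_of_adj d (hadj (2 * s + 1 + j) (by omega)) hup,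
        ih (by omega)]
      have e : (Pi.single 0 ((1 : ℤ) + ((j + 1 : ℕ) : ℤ)) : Site (d + 1)) = Pi.single 0 ((1 : ℤ) + (j : ℕ)) + Pi.single 0 1 := by
        rw [← Pi.single_add]; push_cast; ring_nf
      rw [e]; abel
  -- `w ≠ −v`: else `ω (2s+2) = ω 2`
  have hvw : w ≠ (v.1, !v.2) := by
    intro hwv
    have e2 : ω 2 = Pi.single 0 2 := by rw [P0 2 hs]; norm_num
    have e2' : ω (2 * s + 2) = Pi.single 0 2 := by
      have := P2 1 (by omega)
      rw [show 2 * s + 1 + 1 = 2 * s + 2 by ring] at this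
      rw [this, hwv, twoStepV_not, add_assoc, add_neg_cancel, add_zero]; norm_num
    have := hinj (show 2 * s + 2 ∈ {i | i ≤ 3 * s} by simp only [Set.mem_setOf_eq]; omega)
      (show 2 ∈ {i | i ≤ 3 * s} by simp only [Set.mem_setOf_eq]; omega) (e2'.trans e2.symm)
    omega
  refine ⟨(v, w), Finset.mem_filter.2 ⟨Finset.mem_univ _, hvw⟩, funext fun t => ?_⟩
  rcases Nat.lt_or_ge t (s + 1) with h1 | h1
  · rw [P0 t (by omega), staple_of_le d s _ (by omega)]
  rcases Nat.lt_or_ge t (2 * s + 1) with h2 | h2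
  · obtain ⟨j, rfl⟩ : ∃ j, t = s + 1 + j := ⟨t - s - 1, by omega⟩
    rw [P1 j (by omega), staple_phase_one d s _ (by omega)]
  rcases Nat.lt_or_ge t (3 * s + 1) with h3 | h3
  · obtain ⟨j, rfl⟩ : ∃ j, t = 2 * s + 1 + j := ⟨t - 2 * s - 1, by omega⟩
    rw [P2 j (by omega), staple_phase_two d s _ (by omega)]
  · rw [hend t (by omega), staple_of_ge d s (by omega) _ (by omega)]
    have := P2 (s - 1) (by omega)
    rw [show 2 * s + 1 + (s - 1) = 3 * s by omega] at this
    rw [this]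
    congr 2
    push_cast [Nat.cast_sub (show 1 ≤ s by omega)]; ring

/-- `staple d s` is injective on step data (`s ≥ 1`). [cite: MadrasSlade1993, Definition 1.2.4] -/
theorem staple_injective (d s : ℕ) (hs : 1 ≤ s) : Function.Injective (staple d s) := by
  rintro ⟨v, w⟩ ⟨v', w'⟩ h
  have h1 := congrFun h (s + 1)
  have e1 := staple_phase_one d s (v, w) (j := 0) hs
  have e1' := staple_phase_one d s (v', w') (j := 0) hs
  rw [add_zero] at e1 e1'
  rw [e1, e1', add_right_inj] at h1
  have hv : v = v' := twoStepV_injective d h1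
  have h2 := congrFun h (3 * s)
  rw [staple_of_ge d s hs _ le_rfl, staple_of_ge d s hs _ le_rfl] at h2
  simp only [hv, add_right_inj] at h2
  have hw : w = w' := twoStepV_injective d h2
  rw [hv, hw]

/-- ★ The irreducible bridges of `ℤ^{d+1}` of length `3s` and cost `2s` (`s ≥ 2`) are exactly the staples over `threeStepIndex`.
[cite: MadrasSlade1993, §4.2, remark after Theorem 4.2.4 (p. 94)] -/
theorem filter_costZd_staple_eq_image (d s : ℕ) (hs : 2 ≤ s) [DecidableEq (ℕ → Site (d + 1))] :
    ((irreducibleBridges (d + 1) (3 * s)).filter fun ω => costZd d (3 * s) ω = 2 * s) = (threeStepIndex d).image (staple d s) := by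
  ext ω
  constructor
  · intro h
    obtain ⟨p, hp, rfl⟩ := eq_staple_of_mem d s hs h
    exact Finset.mem_image_of_mem _ hp
  · intro h
    obtain ⟨p, hp, rfl⟩ := Finset.mem_image.1 h
    exact staple_mem_filter d s (by omega) hp

/-- ★★ **`N_{2s,3s}(ℤ^{d+1}) = 2d(2d−1)` for every `s ≥ 2`**: the top-length coefficient of every even cost polynomial of the large-force
expansion is the number of staples, `2d(2d−1)`. [cite: MadrasSlade1993, §4.2, remark after Theorem 4.2.4 (p. 94)] -/
theorem costCoeffZd_two_mul_three_mul (d s : ℕ) (hs : 2 ≤ s) : costCoeffZd d (2 * s) (3 * s) = 2 * d * (2 * d - 1) := by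
  classical
  rw [costCoeffZd, filter_costZd_staple_eq_image d s hs, Finset.card_image_of_injective _ (staple_injective d s (by omega)),
    card_threeStepIndex]

end Literature.Probability.RandomPlanarGeometry.SAW.Zd

end
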